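import Literature.Geometry.Kaehler.ComplexTorusWeightCompactSupport
import Mathlib.MeasureTheory.Function.LocallyIntegrable
import HarnessLib

/-!
# The integral of the fundamental weight is the volume of a fundamental domain

Layer `Literature/Geometry/Kaehler`, namespace `Literature.Geometry.Kaehler.ComplexTorus`; lane
`lit-hodgefound`, prover seat `lit-hodgefound-p07`, generation 19 — fifth rider towards FILE C
(torus glue) of the programme «`[Θ_Ω] = -E_Ω` for every `Ω ∈ 𝔥_g`». For the fundamental weight
`w = w_univ` of the period lattice `Λ = Φ(ℤ^ι)` (Federer 4.1.7: `Σ_{λ ∈ Λ} w(x + λ) = 1`) and a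
`Λ`-invariant locally finite measure `μ`:

* `integral_mul_weight_eq_setIntegral_of_periodic` — for `F` locally integrable and `Λ`-periodic
  `μ`-a.e., `∫ F · w dμ = ∫_{slab} F dμ` (unfold over the slab and use `Σ_m w(Φm + x) = 1`);
* `integral_weight` — in particular `∫ w dμ = μ(slab)`, the covolume.

Theorems only; no definitions, no named facts.

## References

* [Federer1969] H. Federer, *Geometric Measure Theory*, Springer (1969), 4.1.7.
* [Lange2023AbelianVarietiesComplex] H. Lange, *Abelian Varieties over the Complex Numbers* (2023),
  §1.1.1.
-/

noncomputable section

open Set Function MeasureTheory Filter Topology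

namespace Literature.Geometry.Kaehler

namespace ComplexTorus

variable {ι : Type*} [DecidableEq ι] [Fintype ι] {E : Type*} [NormedAddCommGroup E]
  [NormedSpace ℂ E] [MeasurableSpace E] [BorelSpace E] (Φ : (ι → ℝ) ≃L[ℝ] E)

/-- **Unfolding a periodic function against the fundamental weight**: for a `Λ`-invariant locally
finite measure `μ`, `F` locally `μ`-integrable with `F(Φm + ·) = F` `μ`-a.e. for all `m ∈ ℤ^ι`, and
`w` the fundamental weight of `Λ`, `∫ F w dμ = ∫_{slab} F dμ`. [cite: Federer1969, 4.1.7;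
Lange2023AbelianVarietiesComplex, §1.1.1] -/
theorem integral_mul_weight_eq_setIntegral_of_periodic (μ : Measure E)
    [VAddInvariantMeasure (coordSubLattice Φ (Finset.univ : Finset ι)) E μ]
    [IsLocallyFiniteMeasure μ] {F : E → ℝ} (hF : LocallyIntegrable F μ)
    (hper : ∀ m : ((Finset.univ : Finset ι) : Set ι) → ℤ,
      ∀ᵐ x ∂μ, F (latticeVecOn Φ Finset.univ m + x) = F x) :
    ∫ x, F x * weight Φ Finset.univ x ∂μ = ∫ x in slab Φ Finset.univ 0, F x ∂μ := by
  set w := weight Φ (Finset.univ : Finset ι) with hw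
  have hwc : Continuous w := (contDiff_weight Φ Finset.univ (n := 0)).continuous
  have hws : HasCompactSupport w := hasCompactSupport_weight_univ Φ
  have hint_tr : ∀ c : E, Integrable (fun x => F x * w (c + x)) μ := fun c => by
    have hc : Continuous fun x => w (c + x) := hwc.comp (continuous_const.add continuous_id)
    have hs : HasCompactSupport fun x => w (c + x) := by
      simpa [Function.comp_def, add_comm] using hws.comp_homeomorph (Homeomorph.addLeft c)
    simpa [smul_eq_mul] using hF.integrable_smul_right_of_hasCompactSupport hc hs
  have hint : Integrable (fun x => F x * w x) μ := by simpa using hint_tr 0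
  have hG : ∀ (m : ((Finset.univ : Finset ι) : Set ι) → ℤ), ∀ x ∈ slab Φ Finset.univ 0,
      F (latticeVecOn Φ Finset.univ m + x) * w (latticeVecOn Φ Finset.univ m + x) ≠ 0 →
        m ∈ windowOn Finset.univ := fun m x hx hne =>
    mem_windowOn_of_weight_ne_zero Φ Finset.univ
      (fun k hk => mem_Ioo_of_mem_slab Φ Finset.univ hx hk) fun h => hne (by
        have h' : w (latticeVecOn Φ Finset.univ m + x) = 0 := h
        rw [h', mul_zero])
  rw [integral_eq_sum_setIntegral_slab Φ Finset.univ hint (windowOn Finset.univ) hG]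
  have hshift : ∀ m ∈ windowOn (Finset.univ : Finset ι),
      ∫ x in slab Φ Finset.univ 0, F (latticeVecOn Φ Finset.univ m + x) *
          w (latticeVecOn Φ Finset.univ m + x) ∂μ =
        ∫ x in slab Φ Finset.univ 0, F x * w (latticeVecOn Φ Finset.univ m + x) ∂μ := by
    intro m _
    refine integral_congr_ae ?_
    filter_upwards [ae_restrict_of_ae (hper m)] with x hx
    rw [hx]
  rw [Finset.sum_congr rfl hshift, ← integral_finsetSum _ fun m _ => (hint_tr _).integrableOn]
  refine setIntegral_congr_fun (measurableSet_slab Φ Finset.univ 0) fun x hx => ?_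
  rw [← Finset.mul_sum, sum_windowOn_weight Φ Finset.univ
    (fun k hk => mem_Ioo_of_mem_slab Φ Finset.univ hx hk), mul_one]

/-- **`∫ w dμ = μ(slab)`**: the integral of the fundamental weight against a `Λ`-invariant locally
finite measure is the (real) measure of the slab fundamental domain (the covolume; both sides
vanish by convention if the slab has infinite measure). [cite: Federer1969,
4.1.7; Lange2023AbelianVarietiesComplex, §1.1.1] -/
theorem integral_weight (μ : Measure E)
    [VAddInvariantMeasure (coordSubLattice Φ (Finset.univ : Finset ι)) E μ]
    [IsLocallyFiniteMeasure μ] :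
    ∫ x, weight Φ Finset.univ x ∂μ = μ.real (slab Φ Finset.univ 0) := by
  have h := integral_mul_weight_eq_setIntegral_of_periodic Φ μ (F := fun _ => (1 : ℝ))
    (locallyIntegrable_const 1) (fun m => ae_of_all _ fun x => rfl)
  simp only [one_mul] at h
  rw [h, setIntegral_const, smul_eq_mul, mul_one]

end ComplexTorus

end Literature.Geometry.Kaehler
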